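import Literature.Probability.Process.ItoIntegralNegation
import HarnessLib

/-!
# Linearity of the Itô characterisation IN THE INTEGRATOR: `∫ H d(B + B') = ∫ H dB + ∫ H dB'`, `∫ H d(cB) = c ∫ H dB`

Topic `Probability/Process`; theorems only.  Companion of `ItoIntegralLinearity` (linearity in the integrand) and
`ItoIntegralNegation` (`∫ H d(−B) = −∫ H dB`) for the tree's characterised Itô integral `IsItoIntegral H B J 𝓕 μ`
(`J` = u.c.p. limit of the elementary integrals `Hₙ·B` along every approximating sequence of `H`): the elementary
integral is linear in the integrator (`SimpleProcess.integral_add_right`, `SimpleProcess.integral_const_mul_right`),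
u.c.p. convergence is stable under sums and constant multiples (`TendstoUCP.add`, `TendstoUCP.const_mul`), hence

* `IsItoIntegral.add_right` — `IsItoIntegral H B J → IsItoIntegral H B' J' → IsItoIntegral H (B + B') (J + J')`
  (the local-martingale property of `J + J'` as hypothesis; `_of_martingale` version for martingale integrals);
* `IsItoIntegral.const_mul_right` — `IsItoIntegral H B J → IsItoIntegral H (cB) (cJ)` (same two versions);
* `IsItoIntegral.sum_right_of_martingale` — finite linear combinations `∫ H d(Σᵢ cᵢ Bᵢ) = Σᵢ cᵢ ∫ H dBᵢ`.

This is the bilinearity of `(K, M) ↦ K·M` of Revuz–Yor, Ch. IV (eq. (2.4) for elementary integrands, Thm. (2.2) /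
Prop. (2.13) for the extension), read in the characterised form; it is the input for ROTATING the driving noise of an
SDE (an orthogonal transformation `W ↦ R W` of a flat Brownian noise is again flat; the solution's Itô integrals against
`R W` are the corresponding combinations).  Seat `ym-line-csu-p1` g10 (brick «G2» of gauge covariance in law of the
SU(2) lattice Langevin dynamics).

## References
* D. Revuz, M. Yor, *Continuous Martingales and Brownian Motion* (3rd ed., 1999), Ch. IV, eq. (2.4), Thm. (2.2),
  Prop. (2.10), Prop. (2.13).
-/

open MeasureTheory ProbabilityTheory Filter Finset
open scoped NNReal ENNReal Topology

noncomputable section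

namespace Literature.Probability.Process

variable {Ω : Type*} {m : MeasurableSpace Ω}

namespace SimpleProcess

variable {𝓕 : Filtration ℝ≥0 m}

/-- **The elementary integral is additive in the integrator**: `H·(B + B') = H·B + H·B'`.
[cite: RevuzYor1999, Ch. IV eq. (2.4)] -/
theorem integral_add_right (H : SimpleProcess m 𝓕) (B B' : ℝ≥0 → Ω → ℝ) (t : ℝ≥0) (ω : Ω) :
    H.integral (fun s ω ↦ B s ω + B' s ω) t ω = H.integral B t ω + H.integral B' t ω := by
  unfold integral
  rw [← Finset.sum_add_distrib]
  refine Finset.sum_congr rfl fun i _ ↦ ?_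
  ring

/-- **The elementary integral is homogeneous in the integrator**: `H·(cB) = c (H·B)`.
[cite: RevuzYor1999, Ch. IV eq. (2.4)] -/
theorem integral_const_mul_right (H : SimpleProcess m 𝓕) (c : ℝ) (B : ℝ≥0 → Ω → ℝ) (t : ℝ≥0) (ω : Ω) :
    H.integral (fun s ω ↦ c * B s ω) t ω = c * H.integral B t ω := by
  unfold integral
  rw [Finset.mul_sum]
  refine Finset.sum_congr rfl fun i _ ↦ ?_
  ring

end SimpleProcess

/-- **u.c.p. convergence is stable under sums.** [cite: RevuzYor1999, Ch. IV Prop. (2.13)] -/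
theorem TendstoUCP.add {Y Y' : ℕ → ℝ≥0 → Ω → ℝ} {J J' : ℝ≥0 → Ω → ℝ} {P : Measure Ω}
    (h : TendstoUCP Y J P) (h' : TendstoUCP Y' J' P) :
    TendstoUCP (fun n t ω ↦ Y n t ω + Y' n t ω) (fun t ω ↦ J t ω + J' t ω) P := by
  intro t ε hε
  have hε2 : 0 < ε / 2 := by positivity
  have hle : ∀ n, P {ω | ∃ s ≤ t, ε ≤ |Y n s ω + Y' n s ω - (J s ω + J' s ω)|} ≤
      P {ω | ∃ s ≤ t, ε / 2 ≤ |Y n s ω - J s ω|} + P {ω | ∃ s ≤ t, ε / 2 ≤ |Y' n s ω - J' s ω|} := by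
    intro n
    refine (measure_mono ?_).trans (measure_union_le _ _)
    rintro ω ⟨s, hs, hεs⟩
    by_contra hcon
    simp only [Set.mem_union, Set.mem_setOf_eq, not_or, not_exists, not_and, not_le] at hcon
    have h1 := hcon.1 s hs
    have h2 := hcon.2 s hs
    have h3 : |Y n s ω + Y' n s ω - (J s ω + J' s ω)| ≤ |Y n s ω - J s ω| + |Y' n s ω - J' s ω| := by
      rw [show Y n s ω + Y' n s ω - (J s ω + J' s ω) = (Y n s ω - J s ω) + (Y' n s ω - J' s ω) by ring]
      exact abs_add_le _ _
    linarith
  have hlim : Tendsto (fun n ↦ P {ω | ∃ s ≤ t, ε / 2 ≤ |Y n s ω - J s ω|} +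
      P {ω | ∃ s ≤ t, ε / 2 ≤ |Y' n s ω - J' s ω|}) atTop (𝓝 0) := by
    simpa using (h t (ε / 2) hε2).add (h' t (ε / 2) hε2)
  exact tendsto_of_tendsto_of_tendsto_of_le_of_le tendsto_const_nhds hlim (fun n ↦ bot_le) hle

/-- **u.c.p. convergence is stable under constant multiples.** [cite: RevuzYor1999, Ch. IV Prop. (2.13)] -/
theorem TendstoUCP.const_mul {Y : ℕ → ℝ≥0 → Ω → ℝ} {J : ℝ≥0 → Ω → ℝ} {P : Measure Ω}
    (h : TendstoUCP Y J P) (c : ℝ) :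
    TendstoUCP (fun n t ω ↦ c * Y n t ω) (fun t ω ↦ c * J t ω) P := by
  intro t ε hε
  by_cases hc : c = 0
  · have hempty : ∀ n, {ω | ∃ s ≤ t, ε ≤ |c * Y n s ω - c * J s ω|} = ∅ := by
      intro n
      ext ω
      simp only [hc, zero_mul, sub_self, abs_zero, Set.mem_setOf_eq, Set.mem_empty_iff_false, iff_false,
        not_exists, not_and, not_le]
      exact fun _ _ ↦ hε
    simp only [hempty, measure_empty]
    exact tendsto_const_nhds
  · have hcpos : 0 < |c| := abs_pos.mpr hc
    have hset : ∀ n, {ω | ∃ s ≤ t, ε ≤ |c * Y n s ω - c * J s ω|} = {ω | ∃ s ≤ t, ε / |c| ≤ |Y n s ω - J s ω|} := by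
      intro n
      ext ω
      simp only [Set.mem_setOf_eq]
      refine exists_congr fun s ↦ and_congr_right fun _ ↦ ?_
      rw [← mul_sub, abs_mul, div_le_iff₀ hcpos, mul_comm]
    simp only [hset]
    exact h t (ε / |c|) (div_pos hε hcpos)

section Ito

variable {H B B' J J' : ℝ≥0 → Ω → ℝ} {𝓕 : Filtration ℝ≥0 m} {P : Measure Ω}

/-- ★ **`∫ H d(B + B') = ∫ H dB + ∫ H dB'` in the Itô characterisation**: if `J` is the Itô integral of `H` against `B`
and `J'` that against `B'`, and `J + J'` is a local martingale, then `J + J'` is the Itô integral of `H` against `B + B'`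
(same approximating sequences of `H`; `Hₙ·(B + B') = Hₙ·B + Hₙ·B'` converges u.c.p. to `J + J'`).
[cite: RevuzYor1999, Ch. IV Thm. (2.2) and eq. (2.4)] -/
theorem IsItoIntegral.add_right (hJ : IsItoIntegral H B J 𝓕 P) (hJ' : IsItoIntegral H B' J' 𝓕 P)
    (hLM : RandomPlanarGeometry.IsLocalMartingale (fun t ω ↦ J t ω + J' t ω) 𝓕 P) :
    IsItoIntegral H (fun t ω ↦ B t ω + B' t ω) (fun t ω ↦ J t ω + J' t ω) 𝓕 P := by
  obtain ⟨h0, hc, -, hex, hall⟩ := hJ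
  obtain ⟨h0', hc', -, -, hall'⟩ := hJ'
  refine ⟨fun ω ↦ by simp only [h0 ω, h0' ω, add_zero], ?_, hLM, hex, fun Gn hGn ↦ ?_⟩
  · filter_upwards [hc, hc'] with ω hω hω'
    exact hω.add hω'
  · have h2 := (hall Gn hGn).add (hall' Gn hGn)
    have h3 : (fun n ↦ (Gn n).integral fun s ω ↦ B s ω + B' s ω) =
        fun n t ω ↦ (Gn n).integral B t ω + (Gn n).integral B' t ω := by
      funext n t ω
      rw [SimpleProcess.integral_add_right]
    rw [h3]
    exact h2

/-- `IsItoIntegral.add_right` for martingale integrals (the local-martingale hypothesis is automatic).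
[cite: RevuzYor1999, Ch. IV Thm. (2.2) and eq. (2.4)] -/
theorem IsItoIntegral.add_right_of_martingale (hJ : IsItoIntegral H B J 𝓕 P) (hJ' : IsItoIntegral H B' J' 𝓕 P)
    (hM : Martingale J 𝓕 P) (hM' : Martingale J' 𝓕 P) :
    IsItoIntegral H (fun t ω ↦ B t ω + B' t ω) (fun t ω ↦ J t ω + J' t ω) 𝓕 P :=
  hJ.add_right hJ' (hM.add hM').isLocalMartingale

/-- ★ **`∫ H d(cB) = c ∫ H dB` in the Itô characterisation** (local-martingale property of `cJ` as hypothesis).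
[cite: RevuzYor1999, Ch. IV Thm. (2.2) and eq. (2.4)] -/
theorem IsItoIntegral.const_mul_right (hJ : IsItoIntegral H B J 𝓕 P) (c : ℝ)
    (hLM : RandomPlanarGeometry.IsLocalMartingale (fun t ω ↦ c * J t ω) 𝓕 P) :
    IsItoIntegral H (fun t ω ↦ c * B t ω) (fun t ω ↦ c * J t ω) 𝓕 P := by
  obtain ⟨h0, hc, -, hex, hall⟩ := hJ
  refine ⟨fun ω ↦ by simp only [h0 ω, mul_zero], ?_, hLM, hex, fun Gn hGn ↦ ?_⟩
  · filter_upwards [hc] with ω hω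
    exact continuous_const.mul hω
  · have h2 := (hall Gn hGn).const_mul c
    have h3 : (fun n ↦ (Gn n).integral fun s ω ↦ c * B s ω) = fun n t ω ↦ c * (Gn n).integral B t ω := by
      funext n t ω
      rw [SimpleProcess.integral_const_mul_right]
    rw [h3]
    exact h2

/-- `IsItoIntegral.const_mul_right` for martingale integrals. [cite: RevuzYor1999, Ch. IV Thm. (2.2) and eq. (2.4)] -/
theorem IsItoIntegral.const_mul_right_of_martingale (hJ : IsItoIntegral H B J 𝓕 P) (c : ℝ) (hM : Martingale J 𝓕 P) :
    IsItoIntegral H (fun t ω ↦ c * B t ω) (fun t ω ↦ c * J t ω) 𝓕 P := by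
  have hM' : Martingale (fun t ω ↦ c * J t ω) 𝓕 P := by
    have := hM.smul c
    simpa only [Pi.smul_def, smul_eq_mul] using this
  exact hJ.const_mul_right c hM'.isLocalMartingale

/-- ★ **Finite linear combinations of integrators**: if `J i = ∫ H dB i` are martingales for `i ∈ s` (and `H` admits an
approximating sequence — automatic when `s` is nonempty, supplied here as the hypothesis `hex`), then
`Σ_{i∈s} cᵢ J i = ∫ H d(Σ_{i∈s} cᵢ B i)`. [cite: RevuzYor1999, Ch. IV Thm. (2.2) and eq. (2.4)] -/
theorem IsItoIntegral.sum_right_of_martingale {ι : Type*} (s : Finset ι) (c : ι → ℝ)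
    {Bf Jf : ι → ℝ≥0 → Ω → ℝ} [IsFiniteMeasure P]
    (hJ : ∀ i ∈ s, IsItoIntegral H (Bf i) (Jf i) 𝓕 P) (hM : ∀ i ∈ s, Martingale (Jf i) 𝓕 P)
    (hex : ∃ Hn : ℕ → SimpleProcess m 𝓕, SimpleProcess.IsApproxSeq Hn H P) :
    IsItoIntegral H (fun t ω ↦ ∑ i ∈ s, c i * Bf i t ω) (fun t ω ↦ ∑ i ∈ s, c i * Jf i t ω) 𝓕 P := by
  classical
  induction s using Finset.induction_on with
  | empty =>
    simp only [Finset.sum_empty]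
    refine ⟨fun _ ↦ rfl, Eventually.of_forall fun _ ↦ continuous_const,
      (martingale_const 𝓕 P (0 : ℝ)).isLocalMartingale, hex, fun Gn _ ↦ ?_⟩
    intro t ε hε
    have hempty : ∀ n, {ω | ∃ s ≤ t, ε ≤ |(Gn n).integral (fun _ _ ↦ (0 : ℝ)) s ω - 0|} = ∅ := by
      intro n
      ext ω
      simp only [SimpleProcess.integral, sub_self, mul_zero, Finset.sum_const_zero, abs_zero, Set.mem_setOf_eq,
        Set.mem_empty_iff_false, iff_false, not_exists, not_and, not_le]
      exact fun _ _ ↦ hε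
    simp only [hempty, measure_empty]
    exact tendsto_const_nhds
  | insert a s ha ih =>
    have hJ' := ih (fun i hi ↦ hJ i (Finset.mem_insert_of_mem hi)) (fun i hi ↦ hM i (Finset.mem_insert_of_mem hi))
    have hMa : Martingale (fun t ω ↦ c a * Jf a t ω) 𝓕 P := by
      have := (hM a (Finset.mem_insert_self a s)).smul (c a)
      simpa only [Pi.smul_def, smul_eq_mul] using this
    have hMs : Martingale (fun t ω ↦ ∑ i ∈ s, c i * Jf i t ω) 𝓕 P := by
      have key : ∀ (s' : Finset ι), (∀ i ∈ s', Martingale (Jf i) 𝓕 P) →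
          Martingale (fun t ω ↦ ∑ i ∈ s', c i * Jf i t ω) 𝓕 P := by
        intro s' hs'
        induction s' using Finset.induction_on with
        | empty => simpa using martingale_const 𝓕 P (0 : ℝ)
        | insert b s'' hb ih' =>
          have h1 : Martingale (fun t ω ↦ c b * Jf b t ω) 𝓕 P := by
            have := (hs' b (Finset.mem_insert_self b s'')).smul (c b)
            simpa only [Pi.smul_def, smul_eq_mul] using this
          have h2 := ih' (fun i hi ↦ hs' i (Finset.mem_insert_of_mem hi))
          have h3 := h1.add h2
          simp only [Finset.sum_insert hb]
          exact h3
      exact key s (fun i hi ↦ hM i (Finset.mem_insert_of_mem hi))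
    have hsum := ((hJ a (Finset.mem_insert_self a s)).const_mul_right_of_martingale (c a)
      (hM a (Finset.mem_insert_self a s))).add_right_of_martingale hJ' hMa hMs
    simp only [Finset.sum_insert ha]
    exact hsum

end Ito

end Literature.Probability.Process

end
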